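import Literature.Analysis.FluidPDE.SteadyNSPressureSplit
import Literature.Analysis.FluidPDE.HarmonicMeanValueLocal
import Literature.Analysis.FluidPDE.HarmonicProbe
import Literature.Analysis.FluidPDE.HelmholtzAnnihilator
import HarnessLib

/-!
# Steady Navier–Stokes: the gradient of the harmonic part of the pressure

Analysis/FluidPDE proof file (everything PROVED, no definitions, no named facts) on the discharge
path of the named fact `Literature.Analysis.FluidPDE.sereginWang_liouville_L3_annulus`
(Seregin–Wang 2020, Thm 1.1 (i), `q = ℓ = 3`).  With the splitting `p = p̃[χ u] + h` of
`SteadyNSPressureSplit` (`Δh = 0` wherever `χ = 1` locally), the pressure term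
of the localised energy identity needs a bound on the oscillation of `h` over the shell where
the cut-off gradient lives, hence (by `ShellOscillation`) a bound on `sup |∇h|` there.  This file
proves the interior gradient estimate, for every open `U` on which the cut-off `χ` equals `1`
and every `x`, `s > 0` with `B(x, 2s) ⊆ U`:

  `‖∇h(x)‖ ≤ K (s⁻⁵ ∫_{B̄(x,2s)} |u| + s⁻⁴ ∫_{B̄(x,2s)} |u|² + s⁻⁴ ∫_{B̄(x,2s)} |p̃[χ u]|)`
  (`exists_norm_fderiv_harmonicPart_le`, `K` absolute),

by the route "mean value property + the equation + integration by parts", which avoids any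
a-priori control of `p` (none is assumed in Seregin–Wang's theorem):

1. `fderiv_apply_eq_integral_probeBump` — for `h ∈ C³` with `Δh = 0` on `B(x, 2s)`, the local
   weighted mean value property (`HarmonicMeanValueLocal`) applied to the harmonic function
   `∂ₐh` (`Δ∂ₐh = ∂ₐΔh`, `HelmholtzAnnihilator.fderiv_laplacian_apply`) against the unit-mass
   radial bump `χ_s = probeBump s` (`HarmonicProbe`) gives `∂ₐh(x) = ∫ χ_s(z - x) ∂ₐh(z) dz`;
2. `∂ₐh = ∂ₐp − ∂ₐp̃ = ⟨Δu − (u·∇)u, a⟩ − ∂ₐp̃` (the steady equations), and three integrations by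
   parts without boundary terms (`WholeSpaceIBP`, `ClassicalSolutionCalculus`):
   `∫ ψ ⟨Δu, a⟩ = ∫ Δψ ⟨u, a⟩`, `∫ ψ ⟨(u·∇)u, a⟩ = −∫ (Dψ·u) ⟨u, a⟩` (`div u = 0`),
   `∫ ψ ∂ₐq = −∫ ∂ₐψ q` (`IsLerayProfile.integral_mul_fderiv_sub_eq`);
3. the pointwise bounds `|Dχ_s| ≤ K s⁻⁴`, `|Δχ_s| ≤ K s⁻⁵` (dimension `3`) and the support of
   `χ_s(· − x)` in `B̄(x, 2s)`.

## References

* G. Seregin, W. Wang, St. Petersburg Math. J. 31 (2020) = arXiv:1805.02227, Prop. 2.1.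
  [`SereginWang2020`]
* D. Gilbarg, N. S. Trudinger, *Elliptic partial differential equations of second order* (2001),
  Thm 2.1 and (2.19) / Thm 2.10 (interior gradient bounds for harmonic functions).
  [`GilbargTrudinger2001`]
-/

noncomputable section

open MeasureTheory Set Filter Topology InnerProductSpace Function Metric
open scoped RealInnerProductSpace Laplacian ENNReal NNReal ContDiff

namespace Literature.Analysis.FluidPDE

section General

variable {E : Type*} [NormedAddCommGroup E] [InnerProductSpace ℝ E] [FiniteDimensional ℝ E]
  [MeasurableSpace E] [BorelSpace E]

omit [MeasurableSpace E] [BorelSpace E] in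
/-- `Δ(ψ a) = (Δψ) a` for a scalar `ψ ∈ C²` and a constant vector `a`. [folklore] -/
theorem laplacian_mul_smul_const_apply {F : Type*} [NormedAddCommGroup F] [NormedSpace ℝ F]
    {ψ : E → ℝ} (hψ : ContDiff ℝ 2 ψ) (a : F) (z : E) :
    (Δ (fun y => ψ y • a)) z = (Δ ψ) z • a := by
  set l : ℝ →L[ℝ] F := (ContinuousLinearMap.id ℝ ℝ).smulRight a with hl
  have hfun : (fun y => ψ y • a) = l ∘ ψ := by
    funext y; simp [hl]
  rw [hfun, ContDiffAt.laplacian_CLM_comp_left hψ.contDiffAt]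
  simp [hl]

/-- **Mean value representation of the gradient, local form.** For `h ∈ C³(E)` with `Δh = 0`
on the ball `B(x, 2s)` (`s > 0`) and every direction `a`,
`Dh(x) a = ∫ χ_s(z − x) Dh(z) a dz`, `χ_s = probeBump s` the unit-mass radial bump supported in
`|z| ≤ 2s` (the local weighted mean value property of the harmonic function `∂ₐh`,
`Δ∂ₐh = ∂ₐΔh = 0` on the ball). [cite: GilbargTrudinger2001, Thm 2.1] -/
theorem fderiv_apply_eq_integral_probeBump {h : E → ℝ} (hh : ContDiff ℝ 3 h) {x : E} {s : ℝ}
    (hs : 0 < s) (hΔ : ∀ z ∈ ball x (2 * s), (Δ h) z = 0) (a : E) :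
    fderiv ℝ h x a = ∫ z, probeBump s (z - x) * fderiv ℝ h z a := by
  set η : E → ℝ := fun z => fderiv ℝ h z a with hη
  have hη2 : ContDiff ℝ 2 η := (hh.fderiv_right (m := 2) le_rfl).clm_apply contDiff_const
  have hηΔ : ∀ z ∈ ball x (2 * s), (Δ η) z = 0 := fun z hz => by
    rw [hη, ← fderiv_laplacian_apply hh z a]
    have hev : (Δ h) =ᶠ[𝓝 z] fun _ => (0 : ℝ) := by
      filter_upwards [isOpen_ball.mem_nhds hz] with y hy using hΔ y hy
    rw [hev.fderiv_eq]
    simp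
  have hmvp := integral_radial_mul_eq_of_laplacian_eq_zero hη2 (by positivity : 0 < 2 * s) hηΔ
    (contDiff_probeBump s (n := 0)).continuous (fun y hy => probeBump_eq_zero hs hy)
    (fun y z hyz => probeBump_radial s hyz)
  rw [integral_probeBump hs, one_mul] at hmvp
  show η x = ∫ z, probeBump s (z - x) * η z
  rw [← hmvp, ← integral_add_left_eq_self (μ := volume) (fun z => probeBump s (z - x) * η z) x]
  refine integral_congr_ae (Eventually.of_forall fun y => ?_)
  show probeBump s y * η (x + y) = probeBump s (x + y - x) * η (x + y)
  rw [add_sub_cancel_left]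

/-- `∫ ψ ⟨Δu, a⟩ = ∫ (Δψ) ⟨u, a⟩` for `u ∈ C²`, `ψ ∈ C²_c` (Green's second identity,
`integral_inner_laplacian_comm`, with `Δ(ψ a) = (Δψ) a`). [folklore] -/
theorem integral_bump_mul_inner_laplacian_eq {u : E → E} (hu : ContDiff ℝ 2 u) {ψ : E → ℝ}
    (hψ : ContDiff ℝ 2 ψ) (hψc : HasCompactSupport ψ) (a : E) :
    ∫ z, ψ z * ⟪(Δ u) z, a⟫ = ∫ z, (Δ ψ) z * ⟪u z, a⟫ := by
  have hw : ContDiff ℝ 2 fun z => ψ z • a := hψ.smul contDiff_const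
  have hwc : HasCompactSupport fun z => ψ z • a := hψc.smul_right
  have h := integral_inner_laplacian_comm hu hw hwc
  have e1 : ∫ z, ⟪(Δ u) z, ψ z • a⟫ = ∫ z, ψ z * ⟪(Δ u) z, a⟫ :=
    integral_congr_ae (Eventually.of_forall fun z => by
      simp only [real_inner_smul_right])
  have e2 : ∫ z, ⟪u z, (Δ (fun y => ψ y • a)) z⟫ = ∫ z, (Δ ψ) z * ⟪u z, a⟫ :=
    integral_congr_ae (Eventually.of_forall fun z => by
      simp only [laplacian_mul_smul_const_apply hψ a z, real_inner_smul_right])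
  rw [← e1, h, e2]

/-- `∫ ψ ⟨(u·∇)u, a⟩ = −∫ (Dψ·u) ⟨u, a⟩` for a divergence-free `u ∈ C¹` and `ψ ∈ C¹_c` (the
trilinear identity with `w = ψ a`). [folklore] -/
theorem integral_bump_mul_inner_convect_eq {u : E → E} (hu : ContDiff ℝ 1 u)
    (hdiv : VectorCalculus.IsDivFree u) {ψ : E → ℝ} (hψ : ContDiff ℝ 1 ψ)
    (hψc : HasCompactSupport ψ) (a : E) :
    ∫ z, ψ z * ⟪convect u u z, a⟫ = -∫ z, fderiv ℝ ψ z (u z) * ⟪u z, a⟫ := by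
  have hw : ContDiff ℝ 1 fun z => ψ z • a := hψ.smul contDiff_const
  have hwc : HasCompactSupport fun z => ψ z • a := hψc.smul_right
  have h := integral_inner_convect_add_eq_zero (F' := E) hu hu hw hwc
  have e3 : ∫ z, VectorCalculus.divergence u z * ⟪u z, ψ z • a⟫ = 0 := by
    rw [← integral_zero (α := E) (G := ℝ)]
    refine integral_congr_ae (Eventually.of_forall fun z => ?_)
    show VectorCalculus.divergence u z * ⟪u z, ψ z • a⟫ = 0
    rw [hdiv z, zero_mul]
  have e1 : ∫ z, ⟪convect u u z, ψ z • a⟫ = ∫ z, ψ z * ⟪convect u u z, a⟫ :=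
    integral_congr_ae (Eventually.of_forall fun z => by simp only [real_inner_smul_right])
  have e2 : ∫ z, ⟪u z, convect u (fun y => ψ y • a) z⟫ = ∫ z, fderiv ℝ ψ z (u z) * ⟪u z, a⟫ :=
    integral_congr_ae (Eventually.of_forall fun z => by
      show ⟪u z, convect u (fun y => ψ y • a) z⟫ = fderiv ℝ ψ z (u z) * ⟪u z, a⟫
      rw [convect, fderiv_smul_const (hψ.differentiable one_ne_zero z)]
      simp only [ContinuousLinearMap.smulRight_apply, real_inner_smul_right])
  rw [e1, e2, e3, add_zero] at h
  linarith

/-- `∫ ψ ∂ₐq = −∫ ∂ₐψ q` for `q ∈ C¹`, `ψ ∈ C¹_c` (the compact support is on the first factor;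
compare the tree's `integral_mul_fderiv_apply_eq_neg` of `HessianLaplacian`, where it is on the
second). [folklore] -/
theorem integral_mul_fderiv_apply_eq_neg_left {q ψ : E → ℝ} (hq : ContDiff ℝ 1 q) (hψ : ContDiff ℝ 1 ψ)
    (hψc : HasCompactSupport ψ) (a : E) :
    ∫ z, ψ z * fderiv ℝ q z a = -∫ z, fderiv ℝ ψ z a * q z := by
  have h0 := FluidPDE.integral_fderiv_apply_eq_zero (hψ.mul hq) hψc.mul_right a
  have hpt : ∀ z, fderiv ℝ (fun y => ψ y * q y) z a = ψ z * fderiv ℝ q z a + fderiv ℝ ψ z a * q z :=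
    fun z => by
    rw [fderiv_fun_mul (hψ.differentiable one_ne_zero z) (hq.differentiable one_ne_zero z)]
    simp only [_root_.add_apply, _root_.FunLike.coe_smul, Pi.smul_apply, smul_eq_mul]
    ring
  simp_rw [hpt] at h0
  have i1 : Integrable fun z => ψ z * fderiv ℝ q z a :=
    (hψ.continuous.mul ((hq.continuous_fderiv one_ne_zero).clm_apply continuous_const))
      |>.integrable_of_hasCompactSupport hψc.mul_right
  have i2 : Integrable fun z => fderiv ℝ ψ z a * q z :=
    (((hψ.continuous_fderiv one_ne_zero).clm_apply continuous_const).mul hq.continuous)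
      |>.integrable_of_hasCompactSupport (hψc.fderiv_apply (𝕜 := ℝ) a).mul_right
  rw [integral_add i1 i2] at h0
  linarith

/-- **Testing `∂ₐ(p − q)` against a bump, for a steady solution.**  For `IsLerayProfile 1 0 u p`
(`∇p = Δu − (u·∇)u`), `q ∈ C¹` and `ψ ∈ C²_c`,
`∫ ψ ∂ₐ(p − q) = ∫ (Δψ) ⟨u, a⟩ + ∫ (Dψ·u) ⟨u, a⟩ + ∫ ∂ₐψ q`. [folklore] -/
theorem IsLerayProfile.integral_mul_fderiv_sub_eq {u : E → E} {p : E → ℝ}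
    (hprof : IsLerayProfile 1 0 u p) {q : E → ℝ} (hq : ContDiff ℝ 1 q) {ψ : E → ℝ}
    (hψ : ContDiff ℝ 2 ψ) (hψc : HasCompactSupport ψ) (a : E) :
    ∫ z, ψ z * fderiv ℝ (fun y => p y - q y) z a =
      (∫ z, (Δ ψ) z * ⟪u z, a⟫) + (∫ z, fderiv ℝ ψ z (u z) * ⟪u z, a⟫) +
        ∫ z, fderiv ℝ ψ z a * q z := by
  have hu2 : ContDiff ℝ 2 u := hprof.contDiff_velocity
  have hu1 : ContDiff ℝ 1 u := hu2.of_le one_le_two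
  have hp1 : ContDiff ℝ 1 p := hprof.contDiff_pressure
  have hψ1 : ContDiff ℝ 1 ψ := hψ.of_le one_le_two
  -- the steady equations: `∇p = Δu - (u·∇)u`
  have hgrad : ∀ z, gradient p z = (Δ u) z - convect u u z := fun z => by
    have := hprof.profile_eq z
    simp only [one_smul, zero_smul, add_zero] at this
    rw [add_assoc] at this
    rw [neg_add_eq_zero.1 this]
    abel
  -- pointwise: `∂ₐ(p - q) = ⟨Δu, a⟩ - ⟨(u·∇)u, a⟩ - ∂ₐq`
  have hpt : ∀ z, ψ z * fderiv ℝ (fun y => p y - q y) z a =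
      ψ z * ⟪(Δ u) z, a⟫ - ψ z * ⟪convect u u z, a⟫ - ψ z * fderiv ℝ q z a := fun z => by
    have hsub : fderiv ℝ (fun y => p y - q y) z a = fderiv ℝ p z a - fderiv ℝ q z a := by
      rw [fderiv_fun_sub (hp1.differentiable one_ne_zero z) (hq.differentiable one_ne_zero z)]
      rfl
    rw [hsub, ← inner_gradient_left, hgrad z, inner_sub_left]
    ring
  have iA : Integrable fun z => ψ z * ⟪(Δ u) z, a⟫ :=
    (hψ.continuous.mul ((FluidPDE.continuous_laplacian hu2).inner continuous_const))
      |>.integrable_of_hasCompactSupport hψc.mul_right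
  have iB : Integrable fun z => ψ z * ⟪convect u u z, a⟫ :=
    (hψ.continuous.mul (((hu1.continuous_fderiv one_ne_zero).clm_apply hu1.continuous).inner
      continuous_const)).integrable_of_hasCompactSupport hψc.mul_right
  have iC : Integrable fun z => ψ z * fderiv ℝ q z a :=
    (hψ.continuous.mul ((hq.continuous_fderiv one_ne_zero).clm_apply continuous_const))
      |>.integrable_of_hasCompactSupport hψc.mul_right
  have iAB : Integrable fun z => ψ z * ⟪(Δ u) z, a⟫ - ψ z * ⟪convect u u z, a⟫ := iA.sub iB
  have e : ∫ z, ψ z * fderiv ℝ (fun y => p y - q y) z a =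
      (∫ z, ψ z * ⟪(Δ u) z, a⟫) - (∫ z, ψ z * ⟪convect u u z, a⟫) - ∫ z, ψ z * fderiv ℝ q z a := by
    rw [← integral_sub iA iB, ← integral_sub iAB iC]
    exact integral_congr_ae (Eventually.of_forall hpt)
  rw [e, integral_bump_mul_inner_laplacian_eq hu2 hψ hψc a,
    integral_bump_mul_inner_convect_eq hu1 hprof.divFree hψ1 hψc a,
    integral_mul_fderiv_apply_eq_neg_left hq hψ1 hψc a]
  ring

/-! ### Pointwise bounds against a kernel supported in a set -/

/-- `|∫ k f| ≤ M ∫_K ‖f‖` when `|k| ≤ M` and `k = 0` off `K`. [folklore] -/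
theorem abs_integral_mul_le_of_bound {k f : E → ℝ} {K : Set E} {M : ℝ}
    (hk : ∀ z, |k z| ≤ M) (hk0 : ∀ z ∉ K, k z = 0) (hf : IntegrableOn f K) :
    |∫ z, k z * f z| ≤ M * ∫ z in K, ‖f z‖ := by
  rw [← setIntegral_eq_integral_of_forall_compl_eq_zero (s := K) (fun z hz => by
    rw [hk0 z hz, zero_mul])]
  calc |∫ z in K, k z * f z| ≤ ∫ z in K, |k z * f z| := abs_integral_le_integral_abs
    _ ≤ ∫ z in K, M * ‖f z‖ := by
        refine integral_mono_of_nonneg (Eventually.of_forall fun z => abs_nonneg _)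
          (hf.norm.const_mul M) (Eventually.of_forall fun z => ?_)
        show |k z * f z| ≤ M * ‖f z‖
        rw [abs_mul, ← Real.norm_eq_abs (f z)]
        exact mul_le_mul_of_nonneg_right (hk z) (norm_nonneg _)
    _ = M * ∫ z in K, ‖f z‖ := integral_const_mul _ _

end General

/-! ### The translated bumps `χ_s(· − x)` in dimension `3` -/

section Bumps

variable {s : ℝ} {x : EuclideanSpace ℝ (Fin 3)}

/-- The translated bump `z ↦ χ_s(z − x)` vanishes off `B̄(x, 2s)`, with its derivative and
Laplacian. [folklore] -/
theorem probeBump_sub_eq_zero (hs : 0 < s) {z : EuclideanSpace ℝ (Fin 3)}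
    (hz : z ∉ closedBall x (2 * s)) :
    probeBump s (z - x) = 0 ∧ fderiv ℝ (fun y => probeBump s (y - x)) z = 0 ∧
      (Δ (fun y => probeBump s (y - x))) z = 0 := by
  have hzx : z - x ∉ tsupport (probeBump (E := EuclideanSpace ℝ (Fin 3)) s) := fun h => by
    have := tsupport_probeBump_subset hs h
    rw [mem_closedBall_zero_iff] at this
    rw [mem_closedBall, dist_eq_norm] at hz
    exact hz this
  refine ⟨image_eq_zero_of_notMem_tsupport hzx, ?_, ?_⟩
  · rw [fderiv_comp_sub, fderiv_of_notMem_tsupport ℝ hzx]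
  · have : (fun y => probeBump (E := EuclideanSpace ℝ (Fin 3)) s (y - x)) =
        fun y => probeBump s (-x + y) := by
      funext y; rw [sub_eq_neg_add]
    rw [this, laplacian_comp_const_add, FluidPDE.laplacian_eq_zero_of_notMem_tsupport]
    rwa [neg_add_eq_sub]

/-- **Absolute constants for the bumps in dimension `3`**: there is `K ≥ 0` with
`|χ_s| ≤ K s⁻³`, `‖Dχ_s(· − x)‖ ≤ K s⁻⁴` and `|Δχ_s(· − x)| ≤ K s⁻⁵` for all `s > 0`, `x`. [folklore] -/
theorem exists_probeBump_bounds :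
    ∃ K : ℝ, 0 ≤ K ∧ ∀ s : ℝ, 0 < s → ∀ x z : EuclideanSpace ℝ (Fin 3),
      ‖fderiv ℝ (fun y => probeBump s (y - x)) z‖ ≤ K * s⁻¹ ^ 4 ∧
        |(Δ (fun y => probeBump s (y - x))) z| ≤ K * s⁻¹ ^ 5 := by
  obtain ⟨⟨C₁, hC₁⟩, ⟨C₂, hC₂⟩⟩ := exists_bound_baseBump_derivs (E := EuclideanSpace ℝ (Fin 3))
  have hm := baseBumpMass_pos (E := EuclideanSpace ℝ (Fin 3))
  have hC₁0 : 0 ≤ C₁ := le_trans (norm_nonneg _) (hC₁ 0)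
  have hC₂0 : 0 ≤ C₂ := le_trans (abs_nonneg _) (hC₂ 0)
  refine ⟨(baseBumpMass (EuclideanSpace ℝ (Fin 3)))⁻¹ * (C₁ + C₂), by positivity,
    fun s hs x z => ⟨?_, ?_⟩⟩
  · rw [fderiv_comp_sub]
    calc ‖fderiv ℝ (probeBump s) (z - x)‖
        ≤ (baseBumpMass (EuclideanSpace ℝ (Fin 3)) * s ^ Module.finrank ℝ
            (EuclideanSpace ℝ (Fin 3)))⁻¹ * s⁻¹ * C₁ := norm_fderiv_probeBump_le hs hC₁ _
      _ = (baseBumpMass (EuclideanSpace ℝ (Fin 3)))⁻¹ * C₁ * s⁻¹ ^ 4 := by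
          rw [finrank_euclideanSpace, Fintype.card_fin, mul_inv, ← inv_pow]; ring
      _ ≤ (baseBumpMass (EuclideanSpace ℝ (Fin 3)))⁻¹ * (C₁ + C₂) * s⁻¹ ^ 4 := by
          gcongr; linarith
  · have e : (fun y => probeBump (E := EuclideanSpace ℝ (Fin 3)) s (y - x)) =
        fun y => probeBump s (-x + y) := by
      funext y; rw [sub_eq_neg_add]
    rw [e, laplacian_comp_const_add]
    calc |(Δ (probeBump s : EuclideanSpace ℝ (Fin 3) → ℝ)) (-x + z)|
        ≤ (baseBumpMass (EuclideanSpace ℝ (Fin 3)) * s ^ Module.finrank ℝ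
            (EuclideanSpace ℝ (Fin 3)))⁻¹ * s⁻¹ ^ 2 * C₂ := abs_laplacian_probeBump_le hs hC₂ _
      _ = (baseBumpMass (EuclideanSpace ℝ (Fin 3)))⁻¹ * C₂ * s⁻¹ ^ 5 := by
          rw [finrank_euclideanSpace, Fintype.card_fin, mul_inv, ← inv_pow]; ring
      _ ≤ (baseBumpMass (EuclideanSpace ℝ (Fin 3)))⁻¹ * (C₁ + C₂) * s⁻¹ ^ 5 := by
          gcongr; linarith

end Bumps

/-! ### The gradient estimate -/

section Gradient

/-- **Interior gradient estimate for the harmonic part of the pressure.**  There is an absolute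
constant `K` such that for every smooth steady solution `(u, p)` of the Navier–Stokes system on
`ℝ³` (`IsLerayProfile 1 0 u p`, `u`, `p` smooth), every cut-off `χ ∈ C_c^∞`, every open `U` on
which `χ = 1`, and every `s > 0`, `x` with `B(x, 2s) ⊆ U`, the harmonic part `h = p − p̃[χ u]`
satisfies `‖∇h(x)‖ ≤ K (s⁻⁵ ∫_{B̄(x,2s)} |u| + s⁻⁴ (∫_{B̄(x,2s)} |u|² + ∫_{B̄(x,2s)} |p̃[χ u]|))`.
(Mean value property for `∂ₐh` on `B(x, 2s)`, the equation `∇p = Δu − (u·∇)u`, and integration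
by parts onto the bump; Gilbarg–Trudinger (2.19)-type estimate with the right-hand side expressed
through `u` only.) [folklore] -/
theorem exists_norm_fderiv_harmonicPart_le :
    ∃ K : ℝ, 0 ≤ K ∧ ∀ (u : EuclideanSpace ℝ (Fin 3) → EuclideanSpace ℝ (Fin 3))
      (p : EuclideanSpace ℝ (Fin 3) → ℝ), IsLerayProfile 1 0 u p → ContDiff ℝ ∞ u →
      ContDiff ℝ ∞ p → ∀ χ : EuclideanSpace ℝ (Fin 3) → ℝ, ContDiff ℝ ∞ χ → HasCompactSupport χ →
      ∀ U : Set (EuclideanSpace ℝ (Fin 3)), IsOpen U → (∀ y ∈ U, χ y = 1) →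
      ∀ s : ℝ, 0 < s → ∀ x : EuclideanSpace ℝ (Fin 3), ball x (2 * s) ⊆ U →
        ‖fderiv ℝ (fun y => p y - normalisedPressure (fun z => χ z • u z) y) x‖ ≤
          K * (s⁻¹ ^ 5 * (∫ z in closedBall x (2 * s), ‖u z‖) +
            s⁻¹ ^ 4 * ((∫ z in closedBall x (2 * s), ‖u z‖ ^ 2) +
              ∫ z in closedBall x (2 * s), ‖normalisedPressure (fun z => χ z • u z) z‖)) := by
  obtain ⟨K, hK0, hK⟩ := exists_probeBump_bounds
  refine ⟨K, hK0, fun u p hprof hu hp χ hχ hχc U hU hχ1 s hs x hball => ?_⟩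
  set w : EuclideanSpace ℝ (Fin 3) → EuclideanSpace ℝ (Fin 3) := fun z => χ z • u z with hw
  set q : EuclideanSpace ℝ (Fin 3) → ℝ := normalisedPressure w with hq
  set h : EuclideanSpace ℝ (Fin 3) → ℝ := fun y => p y - q y with hh
  set ψ : EuclideanSpace ℝ (Fin 3) → ℝ := fun y => probeBump s (y - x) with hψ
  set B : Set (EuclideanSpace ℝ (Fin 3)) := closedBall x (2 * s) with hB
  -- regularity
  have hwinf : ContDiff ℝ ∞ w := hχ.smul hu
  have hwc : HasCompactSupport w := hχc.smul_right
  have hqinf : ContDiff ℝ ∞ q := contDiff_normalisedPressure_of_contDiff_infty hwinf hwc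
  have hq1 : ContDiff ℝ 1 q := contDiff_infty.1 hqinf 1
  have hhinf : ContDiff ℝ ∞ h := contDiff_pressure_sub_normalisedPressure hu hp hχ hχc
  have hh3 : ContDiff ℝ 3 h := contDiff_infty.1 hhinf 3
  have hψinf : ContDiff ℝ ∞ ψ := (contDiff_probeBump s).comp (contDiff_id.sub contDiff_const)
  have hψ2 : ContDiff ℝ 2 ψ := contDiff_infty.1 hψinf 2
  have hψ1 : ContDiff ℝ 1 ψ := contDiff_infty.1 hψinf 1
  have hψc : HasCompactSupport ψ := by
    refine HasCompactSupport.intro (isCompact_closedBall x (2 * s)) fun z hz => ?_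
    exact (probeBump_sub_eq_zero hs hz).1
  have huc : Continuous u := (contDiff_infty.1 hu 0).continuous
  have hqc : Continuous q := (contDiff_infty.1 hqinf 0).continuous
  -- harmonicity on the ball
  have hΔ : ∀ z ∈ ball x (2 * s), (Δ h) z = 0 := fun z hz =>
    laplacian_pressure_sub_normalisedPressure_eq_zero hprof hu hp hχ hχc hU hχ1 (hball hz)
  -- the representation and the three integrals
  have hrep : ∀ a, fderiv ℝ h x a = (∫ z, (Δ ψ) z * ⟪u z, a⟫) +
      (∫ z, fderiv ℝ ψ z (u z) * ⟪u z, a⟫) + ∫ z, fderiv ℝ ψ z a * q z := fun a => by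
    rw [fderiv_apply_eq_integral_probeBump hh3 hs hΔ a]
    exact hprof.integral_mul_fderiv_sub_eq hq1 hψ2 hψc a
  -- bounds on the three integrals
  have hvan : ∀ z ∉ B, ψ z = 0 ∧ fderiv ℝ ψ z = 0 ∧ (Δ ψ) z = 0 := fun z hz =>
    probeBump_sub_eq_zero hs hz
  have hI1 : ∀ a, |∫ z, (Δ ψ) z * ⟪u z, a⟫| ≤ K * s⁻¹ ^ 5 * (‖a‖ * ∫ z in B, ‖u z‖) := by
    intro a
    have hb := abs_integral_mul_le_of_bound (K := B) (k := fun z => (Δ ψ) z)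
      (f := fun z => ⟪u z, a⟫) (M := K * s⁻¹ ^ 5) (fun z => (hK s hs x z).2)
      (fun z hz => (hvan z hz).2.2)
      ((huc.inner continuous_const).continuousOn.integrableOn_compact (isCompact_closedBall _ _))
    have h2 : ∫ z in B, ‖⟪u z, a⟫‖ ≤ ‖a‖ * ∫ z in B, ‖u z‖ := by
      rw [← integral_const_mul]
      refine integral_mono_of_nonneg (Eventually.of_forall fun z => norm_nonneg _)
        ((huc.norm.continuousOn.integrableOn_compact (isCompact_closedBall _ _)).const_mul ‖a‖)
        (Eventually.of_forall fun z => ?_)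
      calc ‖⟪u z, a⟫‖ ≤ ‖u z‖ * ‖a‖ := norm_inner_le_norm _ _
        _ = ‖a‖ * ‖u z‖ := mul_comm _ _
    exact hb.trans (mul_le_mul_of_nonneg_left h2 (by positivity))
  have hI2 : ∀ a, |∫ z, fderiv ℝ ψ z (u z) * ⟪u z, a⟫| ≤
      K * s⁻¹ ^ 4 * (‖a‖ * ∫ z in B, ‖u z‖ ^ 2) := by
    intro a
    -- write the integrand as `k z * f z` with `k = 1_B-supported`? use the kernel `Dψ z (u z)/‖u z‖`? no:
    -- direct estimate
    rw [← setIntegral_eq_integral_of_forall_compl_eq_zero (s := B)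
      (f := fun z => fderiv ℝ ψ z (u z) * ⟪u z, a⟫) (fun z hz => by
      show fderiv ℝ ψ z (u z) * ⟪u z, a⟫ = 0
      rw [(hvan z hz).2.1]; simp)]
    have hint : IntegrableOn (fun z => ‖u z‖ ^ 2) B :=
      (huc.norm.pow 2).continuousOn.integrableOn_compact (isCompact_closedBall _ _)
    calc |∫ z in B, fderiv ℝ ψ z (u z) * ⟪u z, a⟫|
        ≤ ∫ z in B, |fderiv ℝ ψ z (u z) * ⟪u z, a⟫| := abs_integral_le_integral_abs
      _ ≤ ∫ z in B, K * s⁻¹ ^ 4 * (‖a‖ * ‖u z‖ ^ 2) := by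
          refine integral_mono_of_nonneg (Eventually.of_forall fun z => abs_nonneg _)
            ((hint.const_mul ‖a‖).const_mul _) (Eventually.of_forall fun z => ?_)
          show |fderiv ℝ ψ z (u z) * ⟪u z, a⟫| ≤ K * s⁻¹ ^ 4 * (‖a‖ * ‖u z‖ ^ 2)
          rw [abs_mul]
          calc |fderiv ℝ ψ z (u z)| * |⟪u z, a⟫|
              ≤ (‖fderiv ℝ ψ z‖ * ‖u z‖) * (‖u z‖ * ‖a‖) := by
                refine mul_le_mul ?_ ?_ (abs_nonneg _) (by positivity)
                · rw [← Real.norm_eq_abs]; exact ContinuousLinearMap.le_opNorm _ _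
                · rw [← Real.norm_eq_abs]; exact norm_inner_le_norm _ _
            _ ≤ (K * s⁻¹ ^ 4 * ‖u z‖) * (‖u z‖ * ‖a‖) := by
                gcongr; exact (hK s hs x z).1
            _ = K * s⁻¹ ^ 4 * (‖a‖ * ‖u z‖ ^ 2) := by ring
      _ = K * s⁻¹ ^ 4 * (‖a‖ * ∫ z in B, ‖u z‖ ^ 2) := by
          rw [integral_const_mul, integral_const_mul]
  have hI3 : ∀ a, |∫ z, fderiv ℝ ψ z a * q z| ≤ K * s⁻¹ ^ 4 * (‖a‖ * ∫ z in B, ‖q z‖) := by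
    intro a
    have hb := abs_integral_mul_le_of_bound (K := B) (k := fun z => fderiv ℝ ψ z a)
      (f := q) (M := K * s⁻¹ ^ 4 * ‖a‖) (fun z => by
        rw [← Real.norm_eq_abs]
        calc ‖fderiv ℝ ψ z a‖ ≤ ‖fderiv ℝ ψ z‖ * ‖a‖ := ContinuousLinearMap.le_opNorm _ _
          _ ≤ K * s⁻¹ ^ 4 * ‖a‖ := mul_le_mul_of_nonneg_right (hK s hs x z).1 (norm_nonneg _))
      (fun z hz => by
        show fderiv ℝ ψ z a = 0
        rw [(hvan z hz).2.1]; simp)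
      (hqc.continuousOn.integrableOn_compact (isCompact_closedBall _ _))
    refine hb.trans (le_of_eq ?_)
    ring
  -- assemble the operator norm bound
  refine ContinuousLinearMap.opNorm_le_bound _ (by positivity) fun a => ?_
  rw [Real.norm_eq_abs, hrep a]
  calc |(∫ z, (Δ ψ) z * ⟪u z, a⟫) + (∫ z, fderiv ℝ ψ z (u z) * ⟪u z, a⟫) +
        ∫ z, fderiv ℝ ψ z a * q z|
      ≤ |∫ z, (Δ ψ) z * ⟪u z, a⟫| + |∫ z, fderiv ℝ ψ z (u z) * ⟪u z, a⟫| +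
          |∫ z, fderiv ℝ ψ z a * q z| := abs_add_three _ _ _
    _ ≤ K * s⁻¹ ^ 5 * (‖a‖ * ∫ z in B, ‖u z‖) + K * s⁻¹ ^ 4 * (‖a‖ * ∫ z in B, ‖u z‖ ^ 2) +
          K * s⁻¹ ^ 4 * (‖a‖ * ∫ z in B, ‖q z‖) := add_le_add_three (hI1 a) (hI2 a) (hI3 a)
    _ = K * (s⁻¹ ^ 5 * (∫ z in B, ‖u z‖) + s⁻¹ ^ 4 * ((∫ z in B, ‖u z‖ ^ 2) +
          ∫ z in B, ‖q z‖)) * ‖a‖ := by ring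

end Gradient

end Literature.Analysis.FluidPDE

end
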